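import Summits.CriticalPhenomena.PercolationContinuityZ3.Theorems.PercNearOneGluingNoHeavyQuantDepthTwoRelayRowPointwise
import HarnessLib

/-!
# QUANT lane R8, depth-2 closure (D2) in the RELAY case: THE ONE-ROW LEMMA, part 2 — a single-threshold row of (relay_g) ∗ μ at target
# T + g from ONE two-threshold row of μ at target T (giants, the cheap endpoint, assembly in functional form, and the row-family form
# `relayConv_tlcRow_of_tlc2`: `LawDec.TLC2` of the factor ⟹ the `LawDec.TLC` row of the product)

builds on p205010 (kernel theorem, internal audit signed; external expert review pending)

Support file (`--supports stmt-CriticalPhenomena-4575`), QUANT lane seat prim-quant-census-2 (gen 67); census memo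
`run/shared/lean/prim/quant/prim-quant-census-2-g67/DEPTH2-CLOSURE-G67.md` §4b.  Theorems only, standard axioms, no sorries.

THE LEMMA (relay case of the G₁-third of D2, one depth above G₀'s relay lemma `…QuantDepthOneRelayRow` ✓ p377094).  Floor `0 < y < 1`
(`u = y/(1−y)`), a nonnegative `μ` on `{0..M}`, a relay `ρ = {0: 1−g, 1: g}` with `y ≤ g ≤ 1` (its own top-affordability), a target `T`, a
threshold `1 ≤ i` with `2i < T` (a factor low) and a product layer `i ≤ j`.  Put `s = T − 2i`, `θ₀ = min(1−g, s/(s+g))` and the layer `j*`: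
`j* = j` if `j < M` and the pair `(i, j)` is NOT cheap at `T+g` (`T+g < i+j → u ≤ usage`), `j* = j−1` if `(i, j)` is a compatible cheap mid at
`T+g` (`usage ≤ u`).  IF `μ` satisfies the two-threshold row `TLC2_T(j*, i−1, i, θ₀)` in functional form
`Σ_a μ(a)·C(a) ≤ 0`, `C(a) = u[a ≤ i−1] + uθ₀[a = i] − [j*+1 ≤ a] − u[a ≤ j*]·cap2 y T j* (i−1) i a θ₀`,
THEN `ν = lconv M 1 μ ρ` satisfies the single-threshold row `(j, i)` at `T + g` in functional form
`Σ_h ν(h)·C′(h) ≤ 0`, `C′(h) = u[h ≤ i] − [j+1 ≤ h] − u[h ≤ j ∧ T+g < i+h]/usage y (T+g) j i h`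
(`relayConv_tlcRow_same_layer`, `relayConv_tlcRow_lower_layer`).  PROOF: `Σ_h ν(h)C′(h) = Σ_a μ(a)·((1−g)C′(a) + gC′(a+1))`
(`sum_fun_mul_lconv_one`, lead g38) and the POINTWISE domination `(1−g)C′(a) + gC′(a+1) ≤ C(a)` (`relay_pointwise_*`): equality on the lows
`a ≤ i−1`; at `a = i` the three cases of `C′(i+1)` give exactly `θ₀`; on a mid of the factor row the `θ₀`-branch of `cap2` is the relay
capacity inequality `relay_cap_pairGate` / `relay_cap_pairGate_top` (`…QuantDepthTwoRelayCap`, this seat) and the `(i−1)`-branch is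
monotonicity of the minimal gate in `ρ` (`pairGate_mono_rho`, lead g22 `…QuantSliceTwoRowRates`); the layer rule makes the top atom `a = j` a giant exactly when it must be.
EXACT CENSUS behind the statement (memo §4b, `code/local/local_onerow7.py`): 495 695 instances (floors .2–.9, M ≤ 26, any target, g ∈ [y,1])
/ 0 exceptions.  HONEST STATUS: D2, G₁ and `Quant.FarTreeRow` (light) remain OPEN; nothing here is cited as a published result; the lane's RATE
class log\* and honest sentence (`run/shared/lean/prim/quant/README.md`) are unchanged.

[this work]; bookkeeping `sum_fun_mul_lconv_one`: prim-quant-lead g38 (`…QuantPhantomRelay`); `cap2`/`TLC2`: prim-quant-census-2 g64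
(`…QuantDepthTwoRows`); minimal gates: prim-quant-stmt g22.  The gluing rows served [cite: KozmaNitzan2024, Conjecture 3 (p. 15)]; product measure
[cite: Grimmett1999, §1.3 p. 10].
-/

noncomputable section

namespace Summit.CriticalPhenomena.PercolationContinuityZ3.Theorems

namespace Quant

open Finset

namespace LawDec

/-! ### Pointwise: giants and the cheap endpoint (continued from part 1) -/

/-- **POINTWISE, GIANTS** (`j + 1 ≤ a`): both sides are `−1`. [this work] -/
theorem relay_pointwise_giants (y T g : ℝ) (i j js : ℕ) (Cp Cf : ℕ → ℝ) (hij : i ≤ j) (hjs : js ≤ j)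
    (hCp : ∀ h : ℕ, Cp h = y / (1 - y) * (if h ≤ i then (1 : ℝ) else 0) - (if j + 1 ≤ h then (1 : ℝ) else 0)
      - y / (1 - y) * (if h ≤ j ∧ T + g < (i : ℝ) + h then 1 / usage y (T + g) j i h else 0))
    (hCf : ∀ a : ℕ, Cf a = y / (1 - y) * (if a ≤ i - 1 then (1 : ℝ) else 0)
      + y / (1 - y) * min (1 - g) ((T - 2 * (i : ℝ)) / (T - 2 * (i : ℝ) + g)) * (if a = i then (1 : ℝ) else 0)
      - (if js + 1 ≤ a then (1 : ℝ) else 0) - y / (1 - y) * (if a ≤ js then cap2 y T js (i - 1) i a (min (1 - g) ((T - 2 * (i : ℝ)) / (T - 2 * (i : ℝ) + g))) else 0))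
    (a : ℕ) (ha : j + 1 ≤ a) : (1 - g) * Cp a + g * Cp (a + 1) ≤ Cf a := by
  have hCpa : Cp a = -1 := by
    rw [hCp a, if_neg (by omega), if_pos ha]
    have : ¬ (a ≤ j ∧ T + g < (i : ℝ) + a) := by rintro ⟨h, _⟩; omega
    rw [if_neg this]; ring
  have hCpa1 : Cp (a + 1) = -1 := by
    rw [hCp (a + 1), if_neg (by omega), if_pos (by omega)]
    have : ¬ (a + 1 ≤ j ∧ T + g < (i : ℝ) + ((a + 1 : ℕ) : ℝ)) := by rintro ⟨h, _⟩; omega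
    rw [if_neg this]; ring
  have hCfa : Cf a = -1 := by
    rw [hCf a, if_neg (by omega), if_neg (by omega), if_pos (by omega), if_neg (by omega)]; ring
  rw [hCpa, hCpa1, hCfa]; linarith


/-- **POINTWISE, THE LAYER ENDPOINT, lower-layer case** (`js + 1 = j`, the pair `(i, j)` a compatible CHEAP mid at `T+g`: `usage ≤ y/(1−y)`):
the factor row at layer `j − 1` sees `j` as a giant, and the pull-back's price at `j` is at most `−1`. [this work] -/
theorem relay_pointwise_cheap_top (y T g : ℝ) (i j js : ℕ) (Cp Cf : ℕ → ℝ)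
    (hy0 : 0 < y) (hy1 : y < 1) (hyg : y ≤ g) (hg1 : g ≤ 1) (hij : i < j) (hjs : js + 1 = j) (hlow : 2 * (i : ℝ) < T)
    (hcomp : T + g < (i : ℝ) + j) (hcheap : usage y (T + g) j i j ≤ y / (1 - y))
    (hCp : ∀ h : ℕ, Cp h = y / (1 - y) * (if h ≤ i then (1 : ℝ) else 0) - (if j + 1 ≤ h then (1 : ℝ) else 0)
      - y / (1 - y) * (if h ≤ j ∧ T + g < (i : ℝ) + h then 1 / usage y (T + g) j i h else 0))
    (hCf : ∀ a : ℕ, Cf a = y / (1 - y) * (if a ≤ i - 1 then (1 : ℝ) else 0)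
      + y / (1 - y) * min (1 - g) ((T - 2 * (i : ℝ)) / (T - 2 * (i : ℝ) + g)) * (if a = i then (1 : ℝ) else 0)
      - (if js + 1 ≤ a then (1 : ℝ) else 0) - y / (1 - y) * (if a ≤ js then cap2 y T js (i - 1) i a (min (1 - g) ((T - 2 * (i : ℝ)) / (T - 2 * (i : ℝ) + g))) else 0)) :
    (1 - g) * Cp j + g * Cp (j + 1) ≤ Cf j := by
  have h1y : 0 < 1 - y := by linarith
  have hu0 : 0 < y / (1 - y) := div_pos hy0 h1y
  have hCpj : Cp j = -(y / (1 - y) * (1 / usage y (T + g) j i j)) := by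
    rw [hCp j, if_neg (by omega), if_neg (by omega), if_pos ⟨le_rfl, hcomp⟩]; ring
  have hCpj1 : Cp (j + 1) = -1 := by
    rw [hCp (j + 1), if_neg (by omega), if_pos le_rfl]
    have : ¬ (j + 1 ≤ j ∧ T + g < (i : ℝ) + ((j + 1 : ℕ) : ℝ)) := by rintro ⟨h, _⟩; omega
    rw [if_neg this]; ring
  have hCfj : Cf j = -1 := by
    rw [hCf j, if_neg (by omega), if_neg (by omega), if_pos (by omega), if_neg (by omega)]; ring
  rw [hCpj, hCpj1, hCfj]
  have hX : (1 - y) / y ≤ 1 / usage y (T + g) j i j :=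
    one_div_usage_ge_of_usage_le y (T + g) j i j hy0 hy1 (by linarith [hy0, hyg]) hcomp hcheap
  have hprod : 1 ≤ y / (1 - y) * (1 / usage y (T + g) j i j) := by
    have e : y / (1 - y) * ((1 - y) / y) = 1 := by field_simp
    calc (1 : ℝ) = y / (1 - y) * ((1 - y) / y) := e.symm
      _ ≤ y / (1 - y) * (1 / usage y (T + g) j i j) := mul_le_mul_of_nonneg_left hX hu0.le
  have h1g : 0 ≤ 1 - g := by linarith
  nlinarith [mul_le_mul_of_nonneg_left hprod h1g]

/-! ### The one-row lemma (same-layer case) -/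

/-- **THE ONE-ROW RELAY LEMMA FOR D2's SINGLE-THRESHOLD ROWS, same-layer case.**  `0 < y < 1`, `y ≤ g ≤ 1`, `μ ≥ 0`, `1 ≤ i ≤ j`, `2i < T`,
and the pair `(i, j)` NOT cheap at `T+g` (`T+g < i+j → y/(1−y) ≤ usage y (T+g) j i j`).  If `μ` satisfies the two-threshold row
`(j, i−1, i, θ₀)` at target `T` in functional form (`θ₀ = min(1−g, (T−2i)/(T−2i+g))`), then `ν = lconv M 1 μ {0: 1−g, 1: g}` satisfies the
single-threshold row `(j, i)` at target `T + g` in functional form. [this work] -/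
theorem relayConv_tlcRow_same_layer (y T g : ℝ) (M i j : ℕ) (μ : ℕ → ℝ)
    (hy0 : 0 < y) (hy1 : y < 1) (hyg : y ≤ g) (hg1 : g ≤ 1) (hμ0 : ∀ h, 0 ≤ μ h)
    (hi : 1 ≤ i) (hij : i ≤ j) (hlow : 2 * (i : ℝ) < T)
    (hexp : T + g < (i : ℝ) + j → y / (1 - y) ≤ usage y (T + g) j i j)
    (hrow : ∑ a ∈ Finset.range (M + 1), μ a * (y / (1 - y) * (if a ≤ i - 1 then (1 : ℝ) else 0)
      + y / (1 - y) * min (1 - g) ((T - 2 * (i : ℝ)) / (T - 2 * (i : ℝ) + g)) * (if a = i then (1 : ℝ) else 0)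
      - (if j + 1 ≤ a then (1 : ℝ) else 0)
      - y / (1 - y) * (if a ≤ j then cap2 y T j (i - 1) i a (min (1 - g) ((T - 2 * (i : ℝ)) / (T - 2 * (i : ℝ) + g))) else 0)) ≤ 0) :
    ∑ h ∈ Finset.range (M + 1 + 1), (y / (1 - y) * (if h ≤ i then (1 : ℝ) else 0) - (if j + 1 ≤ h then (1 : ℝ) else 0)
      - y / (1 - y) * (if h ≤ j ∧ T + g < (i : ℝ) + h then 1 / usage y (T + g) j i h else 0))
      * lconv M 1 μ (fun h => if h = 1 then g else if h = 0 then 1 - g else 0) h ≤ 0 := by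
  set Cp : ℕ → ℝ := fun h => y / (1 - y) * (if h ≤ i then (1 : ℝ) else 0) - (if j + 1 ≤ h then (1 : ℝ) else 0)
      - y / (1 - y) * (if h ≤ j ∧ T + g < (i : ℝ) + h then 1 / usage y (T + g) j i h else 0) with hCpdef
  set Cf : ℕ → ℝ := fun a => y / (1 - y) * (if a ≤ i - 1 then (1 : ℝ) else 0)
      + y / (1 - y) * min (1 - g) ((T - 2 * (i : ℝ)) / (T - 2 * (i : ℝ) + g)) * (if a = i then (1 : ℝ) else 0)
      - (if j + 1 ≤ a then (1 : ℝ) else 0)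
      - y / (1 - y) * (if a ≤ j then cap2 y T j (i - 1) i a (min (1 - g) ((T - 2 * (i : ℝ)) / (T - 2 * (i : ℝ) + g))) else 0) with hCfdef
  have hCp : ∀ h : ℕ, Cp h = y / (1 - y) * (if h ≤ i then (1 : ℝ) else 0) - (if j + 1 ≤ h then (1 : ℝ) else 0)
      - y / (1 - y) * (if h ≤ j ∧ T + g < (i : ℝ) + h then 1 / usage y (T + g) j i h else 0) := fun h => rfl
  have hCf : ∀ a : ℕ, Cf a = y / (1 - y) * (if a ≤ i - 1 then (1 : ℝ) else 0)
      + y / (1 - y) * min (1 - g) ((T - 2 * (i : ℝ)) / (T - 2 * (i : ℝ) + g)) * (if a = i then (1 : ℝ) else 0)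
      - (if j + 1 ≤ a then (1 : ℝ) else 0)
      - y / (1 - y) * (if a ≤ j then cap2 y T j (i - 1) i a (min (1 - g) ((T - 2 * (i : ℝ)) / (T - 2 * (i : ℝ) + g))) else 0) := fun a => rfl
  have hrow' : ∑ a ∈ Finset.range (M + 1), μ a * Cf a ≤ 0 := hrow
  show ∑ h ∈ Finset.range (M + 1 + 1), Cp h * lconv M 1 μ (fun h => if h = 1 then g else if h = 0 then 1 - g else 0) h ≤ 0
  rw [sum_fun_mul_lconv_one]
  simp only [show ((0 : ℕ) = 1) = False from by simp, if_true, if_false]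
  -- pointwise domination
  have key : ∀ a : ℕ, (1 - g) * Cp a + g * Cp (a + 1) ≤ Cf a := by
    intro a
    rcases Nat.lt_or_ge i a with hia | hai
    · rcases Nat.lt_or_ge (a + 1) (j + 1) with haj | hja
      · exact relay_pointwise_mids y T g i j j Cp Cf hy0 hy1 hyg hg1 hi hlow hCp hCf a hia (by omega) (by omega)
      · rcases Nat.lt_or_ge j a with hja' | haj'
        · exact relay_pointwise_giants y T g i j j Cp Cf hij le_rfl hCp hCf a (by omega)
        · have haj2 : a = j := by omega
          subst haj2
          exact relay_pointwise_top y T g i a Cp Cf hy0 hy1 hyg hg1 hi hlow hia hexp hCp hCf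
    · exact relay_pointwise_lows y T g i j j Cp Cf hy0 hy1 hyg hi hij hij hlow hCp hCf a hai
  calc ∑ a ∈ Finset.range (M + 1), μ a * ((1 - g) * Cp a + g * Cp (a + 1))
      ≤ ∑ a ∈ Finset.range (M + 1), μ a * Cf a := Finset.sum_le_sum fun a _ => mul_le_mul_of_nonneg_left (key a) (hμ0 a)
    _ ≤ 0 := hrow'

/-- **THE ONE-ROW RELAY LEMMA FOR D2's SINGLE-THRESHOLD ROWS, lower-layer case.**  As `relayConv_tlcRow_same_layer`, but the pair `(i, j)`
is a compatible CHEAP mid of the product at `T+g` (`T+g < i+j`, `usage ≤ y/(1−y)`); then the factor row is taken one layer LOWER, at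
`js = j − 1` (so that `j` is one of its giants). [this work] -/
theorem relayConv_tlcRow_lower_layer (y T g : ℝ) (M i j js : ℕ) (μ : ℕ → ℝ)
    (hy0 : 0 < y) (hy1 : y < 1) (hyg : y ≤ g) (hg1 : g ≤ 1) (hμ0 : ∀ h, 0 ≤ μ h)
    (hi : 1 ≤ i) (hij : i < j) (hjs : js + 1 = j) (hlow : 2 * (i : ℝ) < T)
    (hcomp : T + g < (i : ℝ) + j) (hcheap : usage y (T + g) j i j ≤ y / (1 - y))
    (hrow : ∑ a ∈ Finset.range (M + 1), μ a * (y / (1 - y) * (if a ≤ i - 1 then (1 : ℝ) else 0)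
      + y / (1 - y) * min (1 - g) ((T - 2 * (i : ℝ)) / (T - 2 * (i : ℝ) + g)) * (if a = i then (1 : ℝ) else 0)
      - (if js + 1 ≤ a then (1 : ℝ) else 0)
      - y / (1 - y) * (if a ≤ js then cap2 y T js (i - 1) i a (min (1 - g) ((T - 2 * (i : ℝ)) / (T - 2 * (i : ℝ) + g))) else 0)) ≤ 0) :
    ∑ h ∈ Finset.range (M + 1 + 1), (y / (1 - y) * (if h ≤ i then (1 : ℝ) else 0) - (if j + 1 ≤ h then (1 : ℝ) else 0)
      - y / (1 - y) * (if h ≤ j ∧ T + g < (i : ℝ) + h then 1 / usage y (T + g) j i h else 0))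
      * lconv M 1 μ (fun h => if h = 1 then g else if h = 0 then 1 - g else 0) h ≤ 0 := by
  set Cp : ℕ → ℝ := fun h => y / (1 - y) * (if h ≤ i then (1 : ℝ) else 0) - (if j + 1 ≤ h then (1 : ℝ) else 0)
      - y / (1 - y) * (if h ≤ j ∧ T + g < (i : ℝ) + h then 1 / usage y (T + g) j i h else 0) with hCpdef
  set Cf : ℕ → ℝ := fun a => y / (1 - y) * (if a ≤ i - 1 then (1 : ℝ) else 0)
      + y / (1 - y) * min (1 - g) ((T - 2 * (i : ℝ)) / (T - 2 * (i : ℝ) + g)) * (if a = i then (1 : ℝ) else 0)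
      - (if js + 1 ≤ a then (1 : ℝ) else 0)
      - y / (1 - y) * (if a ≤ js then cap2 y T js (i - 1) i a (min (1 - g) ((T - 2 * (i : ℝ)) / (T - 2 * (i : ℝ) + g))) else 0) with hCfdef
  have hCp : ∀ h : ℕ, Cp h = y / (1 - y) * (if h ≤ i then (1 : ℝ) else 0) - (if j + 1 ≤ h then (1 : ℝ) else 0)
      - y / (1 - y) * (if h ≤ j ∧ T + g < (i : ℝ) + h then 1 / usage y (T + g) j i h else 0) := fun h => rfl
  have hCf : ∀ a : ℕ, Cf a = y / (1 - y) * (if a ≤ i - 1 then (1 : ℝ) else 0)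
      + y / (1 - y) * min (1 - g) ((T - 2 * (i : ℝ)) / (T - 2 * (i : ℝ) + g)) * (if a = i then (1 : ℝ) else 0)
      - (if js + 1 ≤ a then (1 : ℝ) else 0)
      - y / (1 - y) * (if a ≤ js then cap2 y T js (i - 1) i a (min (1 - g) ((T - 2 * (i : ℝ)) / (T - 2 * (i : ℝ) + g))) else 0) := fun a => rfl
  have hrow' : ∑ a ∈ Finset.range (M + 1), μ a * Cf a ≤ 0 := hrow
  show ∑ h ∈ Finset.range (M + 1 + 1), Cp h * lconv M 1 μ (fun h => if h = 1 then g else if h = 0 then 1 - g else 0) h ≤ 0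
  rw [sum_fun_mul_lconv_one]
  simp only [show ((0 : ℕ) = 1) = False from by simp, if_true, if_false]
  have key : ∀ a : ℕ, (1 - g) * Cp a + g * Cp (a + 1) ≤ Cf a := by
    intro a
    rcases Nat.lt_or_ge i a with hia | hai
    · rcases Nat.lt_or_ge (a + 1) (j + 1) with haj | hja
      · exact relay_pointwise_mids y T g i j js Cp Cf hy0 hy1 hyg hg1 hi hlow hCp hCf a hia (by omega) (by omega)
      · rcases Nat.lt_or_ge j a with hja' | haj'
        · exact relay_pointwise_giants y T g i j js Cp Cf hij.le (by omega) hCp hCf a (by omega)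
        · have haj2 : a = j := by omega
          subst haj2
          exact relay_pointwise_cheap_top y T g i a js Cp Cf hy0 hy1 hyg hg1 hij hjs hlow hcomp hcheap hCp hCf
    · exact relay_pointwise_lows y T g i j js Cp Cf hy0 hy1 hyg hi hij.le (by omega) hlow hCp hCf a hai
  calc ∑ a ∈ Finset.range (M + 1), μ a * ((1 - g) * Cp a + g * Cp (a + 1))
      ≤ ∑ a ∈ Finset.range (M + 1), μ a * Cf a := Finset.sum_le_sum fun a _ => mul_le_mul_of_nonneg_left (key a) (hμ0 a)
    _ ≤ 0 := hrow'

/-! ### From the tree's row families: `LawDec.TLC2` of the factor gives the `LawDec.TLC` row of the relay product -/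

/-- bookkeeping: for `d ≤ N`, `Σ_{h ≤ d} f h = Σ_{h ≤ N} [h ≤ d]·f h`. [this work] -/
theorem sum_range_eq_sum_ite_of_le (f : ℕ → ℝ) (N d : ℕ) (hd : d ≤ N) :
    ∑ h ∈ Finset.range (d + 1), f h = ∑ h ∈ Finset.range (N + 1), (if h ≤ d then f h else 0) := by
  rw [← Finset.sum_range_add_sum_Ico _ (show d + 1 ≤ N + 1 by omega)]
  have h1 : ∑ h ∈ Finset.range (d + 1), (if h ≤ d then f h else 0) = ∑ h ∈ Finset.range (d + 1), f h :=
    Finset.sum_congr rfl fun h hh => by rw [Finset.mem_range] at hh; rw [if_pos (by omega)]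
  have h2 : ∑ h ∈ Finset.Ico (d + 1) (N + 1), (if h ≤ d then f h else 0) = 0 :=
    Finset.sum_eq_zero fun h hh => by rw [Finset.mem_Ico] at hh; rw [if_neg (by omega)]
  rw [h1, h2, add_zero]

/-- **the `TLC2` row `(j*, i−1, i, θ)` in functional form**: `TLC2 y T M μ`, `j* < M`, `1 ≤ i ≤ j*`, `2i < T`, `0 ≤ θ ≤ 1` ⟹
`Σ_{a ≤ M} μ a · (u[a ≤ i−1] + uθ[a = i] − [j*+1 ≤ a] − u[a ≤ j*]·cap2 y T j* (i−1) i a θ) ≤ 0`. [this work] -/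
theorem tlc2Row_functional (y T θ : ℝ) (M js i : ℕ) (μ : ℕ → ℝ) (hT : TLC2 y T M μ) (hjs : js < M) (hi : 1 ≤ i) (hijs : i ≤ js)
    (hlow : 2 * (i : ℝ) < T) (hθ0 : 0 ≤ θ) (hθ1 : θ ≤ 1) :
    ∑ a ∈ Finset.range (M + 1), μ a * (y / (1 - y) * (if a ≤ i - 1 then (1 : ℝ) else 0)
      + y / (1 - y) * θ * (if a = i then (1 : ℝ) else 0)
      - (if js + 1 ≤ a then (1 : ℝ) else 0)
      - y / (1 - y) * (if a ≤ js then cap2 y T js (i - 1) i a θ else 0)) ≤ 0 := by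
  have row := hT js (i - 1) i θ hjs (by omega) hijs hlow hθ0 hθ1
  have hi1 : i - 1 + 1 = i := by omega
  rw [hi1] at row
  -- the pieces of the functional sum
  have e1 : ∑ a ∈ Finset.range (M + 1), μ a * (y / (1 - y) * (if a ≤ i - 1 then (1 : ℝ) else 0))
      = y / (1 - y) * ∑ l ∈ Finset.range (i - 1 + 1), μ l := by
    rw [sum_range_eq_sum_ite_of_le μ M (i - 1) (by omega), Finset.mul_sum]
    exact Finset.sum_congr rfl fun a _ => by split_ifs <;> ring
  have e2 : ∑ a ∈ Finset.range (M + 1), μ a * (y / (1 - y) * θ * (if a = i then (1 : ℝ) else 0))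
      = y / (1 - y) * θ * ∑ l ∈ Finset.Ico i (i + 1), μ l := by
    rw [Nat.Ico_succ_singleton, Finset.sum_singleton]
    have : ∀ a : ℕ, μ a * (y / (1 - y) * θ * (if a = i then (1 : ℝ) else 0)) = if a = i then y / (1 - y) * θ * μ i else 0 := by
      intro a; split_ifs with h
      · rw [h]; ring
      · ring
    simp_rw [this]
    rw [Finset.sum_ite_eq' (Finset.range (M + 1)) i, if_pos (Finset.mem_range.2 (by omega))]
  have e3 : ∑ a ∈ Finset.range (M + 1), μ a * (if js + 1 ≤ a then (1 : ℝ) else 0)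
      = ∑ h ∈ Finset.range (M + 1), (if js + 1 ≤ h then μ h else 0) :=
    Finset.sum_congr rfl fun a _ => by split_ifs <;> ring
  have e4 : ∑ a ∈ Finset.range (M + 1), μ a * (y / (1 - y) * (if a ≤ js then cap2 y T js (i - 1) i a θ else 0))
      = y / (1 - y) * ∑ h ∈ Finset.range (M + 1), (if h ≤ js then μ h * cap2 y T js (i - 1) i h θ else 0) := by
    rw [Finset.mul_sum]
    exact Finset.sum_congr rfl fun a _ => by split_ifs <;> ring
  have hsplit : ∑ a ∈ Finset.range (M + 1), μ a * (y / (1 - y) * (if a ≤ i - 1 then (1 : ℝ) else 0)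
      + y / (1 - y) * θ * (if a = i then (1 : ℝ) else 0)
      - (if js + 1 ≤ a then (1 : ℝ) else 0)
      - y / (1 - y) * (if a ≤ js then cap2 y T js (i - 1) i a θ else 0))
      = ∑ a ∈ Finset.range (M + 1), μ a * (y / (1 - y) * (if a ≤ i - 1 then (1 : ℝ) else 0))
        + ∑ a ∈ Finset.range (M + 1), μ a * (y / (1 - y) * θ * (if a = i then (1 : ℝ) else 0))
        - ∑ a ∈ Finset.range (M + 1), μ a * (if js + 1 ≤ a then (1 : ℝ) else 0)
        - ∑ a ∈ Finset.range (M + 1), μ a * (y / (1 - y) * (if a ≤ js then cap2 y T js (i - 1) i a θ else 0)) := by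
    rw [← Finset.sum_add_distrib, ← Finset.sum_sub_distrib, ← Finset.sum_sub_distrib]
    exact Finset.sum_congr rfl fun a _ => by ring
  rw [hsplit, e1, e2, e3, e4]
  rw [hi1] 
  have : y / (1 - y) * ∑ l ∈ Finset.range i, μ l + y / (1 - y) * θ * ∑ l ∈ Finset.Ico i (i + 1), μ l
      = y / (1 - y) * (∑ l ∈ Finset.range i, μ l + θ * ∑ l ∈ Finset.Ico i (i + 1), μ l) := by ring
  linarith [row, this]

/-- **a single-threshold row from its functional form**: `i ≤ j ≤ N` and `Σ_{h ≤ N} C′(h)·ν h ≤ 0` with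
`C′(h) = u[h ≤ i] − [j+1 ≤ h] − u[h ≤ j ∧ T′ < i+h]/usage y T′ j i h` ⟹ the body of the `TLC` row `(j, i)` of `ν` on `{0..N}` at `(y, T′)`. [this work] -/
theorem tlcRow_of_functional (y T' : ℝ) (N i j : ℕ) (ν : ℕ → ℝ) (hij : i ≤ j) (hjN : j ≤ N)
    (h : ∑ h ∈ Finset.range (N + 1), (y / (1 - y) * (if h ≤ i then (1 : ℝ) else 0) - (if j + 1 ≤ h then (1 : ℝ) else 0)
      - y / (1 - y) * (if h ≤ j ∧ T' < (i : ℝ) + h then 1 / usage y T' j i h else 0)) * ν h ≤ 0) :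
    y / (1 - y) * ∑ l ∈ Finset.range (i + 1), ν l
      ≤ ∑ h ∈ Finset.range (N + 1), (if j + 1 ≤ h then ν h else 0)
        + y / (1 - y) * ∑ h ∈ Finset.range (N + 1), (if h ≤ j ∧ T' < (i : ℝ) + h then ν h / usage y T' j i h else 0) := by
  have e1 : ∑ h ∈ Finset.range (N + 1), (y / (1 - y) * (if h ≤ i then (1 : ℝ) else 0)) * ν h
      = y / (1 - y) * ∑ l ∈ Finset.range (i + 1), ν l := by
    rw [sum_range_eq_sum_ite_of_le ν N i (by omega), Finset.mul_sum]
    exact Finset.sum_congr rfl fun a _ => by split_ifs <;> ring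
  have e2 : ∑ h ∈ Finset.range (N + 1), (if j + 1 ≤ h then (1 : ℝ) else 0) * ν h
      = ∑ h ∈ Finset.range (N + 1), (if j + 1 ≤ h then ν h else 0) :=
    Finset.sum_congr rfl fun a _ => by split_ifs <;> ring
  have e3 : ∑ h ∈ Finset.range (N + 1), (y / (1 - y) * (if h ≤ j ∧ T' < (i : ℝ) + h then 1 / usage y T' j i h else 0)) * ν h
      = y / (1 - y) * ∑ h ∈ Finset.range (N + 1), (if h ≤ j ∧ T' < (i : ℝ) + h then ν h / usage y T' j i h else 0) := by
    rw [Finset.mul_sum]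
    exact Finset.sum_congr rfl fun a _ => by split_ifs <;> ring
  have hsplit : ∑ h ∈ Finset.range (N + 1), (y / (1 - y) * (if h ≤ i then (1 : ℝ) else 0) - (if j + 1 ≤ h then (1 : ℝ) else 0)
      - y / (1 - y) * (if h ≤ j ∧ T' < (i : ℝ) + h then 1 / usage y T' j i h else 0)) * ν h
      = ∑ h ∈ Finset.range (N + 1), (y / (1 - y) * (if h ≤ i then (1 : ℝ) else 0)) * ν h
        - ∑ h ∈ Finset.range (N + 1), (if j + 1 ≤ h then (1 : ℝ) else 0) * ν h
        - ∑ h ∈ Finset.range (N + 1), (y / (1 - y) * (if h ≤ j ∧ T' < (i : ℝ) + h then 1 / usage y T' j i h else 0)) * ν h := by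
    rw [← Finset.sum_sub_distrib, ← Finset.sum_sub_distrib]
    exact Finset.sum_congr rfl fun a _ => by ring
  rw [hsplit, e1, e2, e3] at h
  linarith

/-- **THE ONE-ROW RELAY LEMMA, ROW-FAMILY FORM.**  `0 < y < 1`, `y ≤ g ≤ 1`, `μ ≥ 0` with `TLC2 y T M μ`; a threshold `1 ≤ i` with `2i < T` and a layer
`i ≤ j ≤ M`; either (`j < M` and the pair `(i, j)` is not a cheap mid at `T + g`: `T+g < i+j → y/(1−y) ≤ usage y (T+g) j i j`) or (`(i, j)` is a compatible
cheap mid at `T + g`: `T + g < i + j` and `usage y (T+g) j i j ≤ y/(1−y)`).  Then `ν = lconv M 1 μ {0: 1−g, 1: g}` satisfies the body of the `LawDec.TLC` row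
`(j, i)` at floor `y`, target `T + g` on `{0..M+1}`. [this work] -/
theorem relayConv_tlcRow_of_tlc2 (y T g : ℝ) (M i j : ℕ) (μ : ℕ → ℝ)
    (hy0 : 0 < y) (hy1 : y < 1) (hyg : y ≤ g) (hg1 : g ≤ 1) (hμ0 : ∀ h, 0 ≤ μ h) (hT2 : TLC2 y T M μ)
    (hi : 1 ≤ i) (hij : i ≤ j) (hjM : j ≤ M) (hlow : 2 * (i : ℝ) < T)
    (hcase : (j < M ∧ (T + g < (i : ℝ) + j → y / (1 - y) ≤ usage y (T + g) j i j))
      ∨ (T + g < (i : ℝ) + j ∧ usage y (T + g) j i j ≤ y / (1 - y))) :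
    y / (1 - y) * ∑ l ∈ Finset.range (i + 1), lconv M 1 μ (fun h => if h = 1 then g else if h = 0 then 1 - g else 0) l
      ≤ ∑ h ∈ Finset.range (M + 1 + 1), (if j + 1 ≤ h then lconv M 1 μ (fun h => if h = 1 then g else if h = 0 then 1 - g else 0) h else 0)
        + y / (1 - y) * ∑ h ∈ Finset.range (M + 1 + 1), (if h ≤ j ∧ T + g < (i : ℝ) + h then
            lconv M 1 μ (fun h => if h = 1 then g else if h = 0 then 1 - g else 0) h / usage y (T + g) j i h else 0) := by
  have hg0 : 0 < g := lt_of_lt_of_le hy0 hyg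
  have hs : 0 < T - 2 * (i : ℝ) := by linarith
  have hθ0 : 0 ≤ min (1 - g) ((T - 2 * (i : ℝ)) / (T - 2 * (i : ℝ) + g)) :=
    le_min (by linarith) (div_pos hs (by linarith)).le
  have hθ1 : min (1 - g) ((T - 2 * (i : ℝ)) / (T - 2 * (i : ℝ) + g)) ≤ 1 := le_trans (min_le_left _ _) (by linarith)
  refine tlcRow_of_functional y (T + g) (M + 1) i j _ hij (by omega) ?_
  rcases hcase with ⟨hjM', hexp⟩ | ⟨hcomp, hcheap⟩
  · -- same layer
    exact relayConv_tlcRow_same_layer y T g M i j μ hy0 hy1 hyg hg1 hμ0 hi hij hlow hexp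
      (tlc2Row_functional y T _ M j i μ hT2 hjM' hi hij hlow hθ0 hθ1)
  · -- lower layer: i < j (a compatible mid of i at T + g cannot be i itself, 2i < T)
    have hij' : i < j := by
      rcases hij.eq_or_lt with h | h
      · exfalso
        rw [← h] at hcomp
        linarith
      · exact h
    obtain ⟨js, hjs⟩ : ∃ js, js + 1 = j := ⟨j - 1, by omega⟩
    exact relayConv_tlcRow_lower_layer y T g M i j js μ hy0 hy1 hyg hg1 hμ0 hi hij' hjs hlow hcomp hcheap
      (tlc2Row_functional y T _ M js i μ hT2 (by omega) hi (by omega) hlow hθ0 hθ1)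

end LawDec

end Quant

end Summit.CriticalPhenomena.PercolationContinuityZ3.Theorems
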